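import Literature.NumberTheory.EllipticCurves.SelmerRestrictionCorankRelative
import Literature.NumberTheory.EllipticCurves.IwasawaSelmer
import HarnessLib

/-!
# Prime-to-`p` Galois descent for `Sel_{p^∞}` over INFINITE extensions (`ℚ_∞ ⊂ F_∞`): the restriction `Sel_{p^∞}(E/L') → Sel_{p^∞}(E/L)^{Gal(L/L')}` is an isomorphism when `p ∤ [L : L']` — kernel brick 1 of the transport [C] (cell `b2b-bsdres`, seat additive-p1, gen 8)

HONEST FRAMING (cell `b2b-bsdres`, run/shared/lean/b2b/bsd-rank1-residual/, verbatim in every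
file): the goal of the cell is to DELETE the COMBINATION-SHAPED residual classes of the
Birch–Swinnerton-Dyer formula for ALL analytic-rank `≤ 1` elliptic curves over `ℚ` — "full BSD
formula for every rank `≤ 1` curve in class `C`" assembled STRICTLY from published theorems — so
that the rank-`≤ 1` remainder becomes exactly the CONSTRUCTION-SHAPED classes, which are TYPED
(missing-input `Prop`s), NOT attempted. This is not "finishing BSD". The additive sub-cell (seats
additive-p1…p4) is a RESEARCH ROUTE on the construction-shaped classes X3/X4; sub-cell additive-p1
= the potentially MULTIPLICATIVE additive prime (X3♯(M) / X4(M)); no claim beyond the stated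
classes; the labels of X3/X4 are UNCHANGED by this file; nothing is booked.

Theorems only (no definition, no named fact). WHY THIS FILE: after gen 7 the ONLY non-published
input of the rank-`0` upper half `ord_p #Ш(E) ≤ ord_p #Ш_an(E)` on X3♯(M) and X4(M) is the typed
predicate `ChiBranchLeadingTerm[Odd][BigImage]At W p` (`Additive/ChiBranchInput*.lean`) = [B∘C],
whose unprinted half is the TRANSPORT
[C] `X(E/ℚ_∞) ≅ X(E♭/ℚ(μ_{p^∞}))^{(χ_p)}` for `E = E♭ ⊗ χ_p`
(Greenberg, LNM 1716 (1999) §5, p. 143 prints the trivial-character case: "The restriction map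
`H¹(ℚ_Σ/ℚ_∞, C) → H¹(ℚ_Σ/F_∞, C)^Δ` is an isomorphism … Taking into account the local
conditions, the restriction map induces an isomorphism"). [C] factors as
(i) the prime-to-`p` Galois descent `Sel_{p^∞}(E/ℚ_∞) ≅ Sel_{p^∞}(E/F_∞)^{Gal(F_∞/ℚ_∞)}` along
`F_∞ = F·ℚ_∞` (`F = ℚ(√p*)` or `ℚ(μ_p)`, degree prime to `p`), and (ii) the twist
identification `Sel_{p^∞}(E/F_∞) ≅ Sel_{p^∞}(E♭/F_∞)` over `F_∞ ∋ √p*` with the Galois action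
multiplied by `χ_p`. THIS FILE PROVES (i), in the tree's subgroup model of Selmer groups over
arbitrary normal extensions (`WeierstrassCurve.selmerGroupOver W p H`, `L = K̄^H`, file
`SubgroupSelmer`; Greenberg's `Sel_E(F_∞)_p`, the convention of the tree's Iwasawa theory):

* `selmerRelRestriction_bijective_of_coprime` — for an elliptic curve `E = W` over a number field
  `K`, a prime `p`, a CLOSED normal subgroup `H' ≤ Γ_K` (`L' = K̄^{H'}`, ANY Galois extension,
  e.g. `K_∞`) and `H = H' ⊓ U` for an OPEN normal subgroup `U` (`L = L'·K̄^U`) with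
  `p ∤ [H' : H] = [L : L']`: the restriction
  `Sel_{p^∞}(E/L') → Sel_{p^∞}(E/L)^{Gal(L/L')}` (`selmerRelRestriction`, file
  `SelmerRestrictionCorankRelative`) is a BIJECTION;
* `selmerInfty_relRestriction_bijective` — the case `H' = Gal(K̄/K_∞)` of a `ℤ_p`-extension
  `κ` (`Sel_{p^∞}(E/K_∞) = W.selmerInfty κ`) and `U` open normal with `p ∤ [Γ_K : U]`:
  `Sel_{p^∞}(E/K_∞) ≅ Sel_{p^∞}(E/K_∞·K̄^U)^{Gal}` — Greenberg's display, for `E[p^∞]` in place of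
  his rank-one `C`, over any number field.

The tree's relative Lemma 4.14 (`SelmerRestrictionCorankRelative`: kernel killed by `[H' : H]`,
cokernel by `[H' : H]²`, Dokchitser–Dokchitser 2010 Lemma 4.14 by `cor ∘ res` / `res ∘ cor` inside
`H'`, locally inside `H'_{K_v}`) assumes `H` (hence `H'`) OPEN in `Γ_K`, i.e. `L`, `L'` number
fields; its proofs use openness only RELATIVELY (`H ∩ H'` open in `H'`, `H_{K_v}` open in
`H'_{K_v}`). §1–§2 re-run them under the relative hypothesis `H = H' ⊓ U`, `U` open (so that
`H_{K_v} = H'_{K_v} ⊓ U_{K_v}` is open in `H'_{K_v}` at every place); §3 adds the arithmetic of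
`p`-primary groups (`H¹(H', E[p^∞])` is `p`-primary for `H'` closed in the compact `Γ_K`):
multiplication by an integer prime to `p` is bijective, so "kernel killed by `n`, cokernel by
`n²`" with `p ∤ n` is "bijective". Brick (ii) and the `Λ`-module packaging are NOT in this file
(design: HOME/b2b-bsdres-additive-p1/KERNEL-C-P3.md); nothing here is specific to X3/X4.

References: R. Greenberg, *Iwasawa theory for elliptic curves*, LNM 1716 (1999), §5 p. 143
(display) and §3 (restriction in towers) [GreenbergLNM1716]; T. Dokchitser, V. Dokchitser, Ann.
of Math. 172 (2010), Lemma 4.14 (proof) [DokchitserDokchitserAnnals2010]; J.-P. Serre, *Galois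
Cohomology* (1997), I.§2.4 [SerreGaloisCohomology1997].
-/

noncomputable section

open scoped Classical

universe u

namespace Summit.BirchSwinnertonDyer.Rank1Residual.AdditivePotMult

open Literature.NumberTheory.EllipticCurves Literature.NumberTheory.GaloisRepresentations
  WeierstrassCurve

/-! ## §0 Arithmetic of `p`-primary groups: multiplication by `n`, `p ∤ n`, is bijective -/

section Primary

variable {X : Type*} [AddCommGroup X] {p : ℕ}

/-- In an abelian group in which every element is killed by a power of the prime `p`,
`n • x = 0` with `n` prime to `p` forces `x = 0` (Bézout). [folklore] -/
theorem eq_zero_of_nsmul_eq_zero_of_coprime (hX : ∀ x : X, ∃ k : ℕ, p ^ k • x = 0) {n : ℕ}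
    (hn : n.Coprime p) {x : X} (hx : n • x = 0) : x = 0 := by
  obtain ⟨k, hk⟩ := hX x
  have hcop : (n : ℤ).gcd (p ^ k : ℕ) = 1 := by
    rw [Int.gcd_natCast_natCast]
    exact Nat.Coprime.pow_right k hn
  have hbez := Int.gcd_eq_gcd_ab (n : ℤ) ((p ^ k : ℕ) : ℤ)
  rw [hcop] at hbez
  have h1 : (1 : ℤ) • x = ((n : ℤ) * (n : ℤ).gcdA ((p ^ k : ℕ) : ℤ) +
      ((p ^ k : ℕ) : ℤ) * (n : ℤ).gcdB ((p ^ k : ℕ) : ℤ)) • x := by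
    rw [← hbez]; rfl
  rw [one_zsmul, add_zsmul, mul_comm (n : ℤ), mul_comm ((p ^ k : ℕ) : ℤ), mul_zsmul, mul_zsmul,
    natCast_zsmul, natCast_zsmul, hx, hk, zsmul_zero, zsmul_zero, add_zero] at h1
  exact h1

/-- In an abelian group in which every element is killed by a power of the prime `p`, every
element is an `n`-th multiple when `n` is prime to `p` (`n m ≡ 1 (mod p^{k+1})`). [folklore] -/
theorem exists_nsmul_eq_of_coprime [Fact p.Prime] (hX : ∀ x : X, ∃ k : ℕ, p ^ k • x = 0)
    {n : ℕ} (hn : n.Coprime p) (x : X) : ∃ y : X, n • y = x := by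
  obtain ⟨k, hk⟩ := hX x
  have hk1 : p ^ (k + 1) • x = 0 := by rw [pow_succ', mul_nsmul', hk, nsmul_zero]
  have hlt : 1 < p ^ (k + 1) := Nat.one_lt_pow (Nat.succ_ne_zero k) (Fact.out : p.Prime).one_lt
  obtain ⟨m, -, hm⟩ := Nat.exists_mul_mod_eq_one_of_coprime (Nat.Coprime.pow_right (k + 1) hn) hlt
  refine ⟨m • x, ?_⟩
  have hdm := Nat.div_add_mod (n * m) (p ^ (k + 1))
  rw [hm] at hdm
  calc n • m • x = (n * m) • x := (mul_nsmul' x n m).symm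
    _ = (p ^ (k + 1) * (n * m / p ^ (k + 1)) + 1) • x := by rw [hdm]
    _ = x := by rw [add_nsmul, one_nsmul, mul_nsmul, hk1, nsmul_zero, zero_add]

/-- Multiplication by `n` prime to `p` is a bijection of a `p`-primary abelian group. [folklore] -/
theorem nsmul_bijective_of_coprime [Fact p.Prime] (hX : ∀ x : X, ∃ k : ℕ, p ^ k • x = 0)
    {n : ℕ} (hn : n.Coprime p) : Function.Bijective fun x : X ↦ n • x := by
  refine ⟨fun x y hxy ↦ ?_, fun x ↦ exists_nsmul_eq_of_coprime hX hn x⟩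
  have h0 : n • (x - y) = 0 := by rw [nsmul_sub, sub_eq_zero]; exact hxy
  exact sub_eq_zero.mp (eq_zero_of_nsmul_eq_zero_of_coprime hX hn h0)

end Primary

/-! ## §1 Generic: `res : H¹(B, M) → H¹(A, M)` for `A ≤ B` open IN `B` (no openness in `G`) -/

section Generic

variable {G : Type u} [Group G] [TopologicalSpace G] [IsTopologicalGroup G]
variable {A B : Subgroup G}
variable (M : Type u) [AddCommGroup M] [DistribMulAction G M] [TopologicalSpace M]
  [DiscreteTopology M]

omit [IsTopologicalGroup G] in
/-- If `A = B ⊓ U` with `U` open in `G`, then `A ∩ B` is open in `B` (no openness of `A` or `B`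
in `G` is needed). [folklore] -/
theorem isOpen_subgroupOf_of_eq_inf {U : Subgroup G} (hU : IsOpen (U : Set G)) (hA : A = B ⊓ U) :
    IsOpen (A.subgroupOf B : Set B) := by
  rw [hA, Subgroup.inf_subgroupOf_left]
  exact hU.preimage continuous_subtype_val

/-- The kernel of `res : H¹(B, M) → H¹(A, M)` is killed by `[B : A]`, for `A ≤ B` of finite index
and open IN `B` (`cor ∘ res` inside `B`; `B` need not be open in `G`). Serre, *Galois
Cohomology*, I.§2.4. [cite: SerreGaloisCohomology1997, I.§2.4] -/
theorem relIndex_nsmul_eq_zero_of_resOfLe_eq_zero_rel (h : A ≤ B)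
    (hAB : IsOpen (A.subgroupOf B : Set B)) [(A.subgroupOf B).FiniteIndex] {x : subgroupH1 B M}
    (hx : resOfLe M h x = 0) : A.relIndex B • x = 0 := by
  haveI : Fintype (B ⧸ A.subgroupOf B) := Fintype.ofFinite _
  have h0 : resSubgroupH1 (A.subgroupOf B) M x = 0 := by
    rw [resSubgroupH1_subgroupOf_eq M h, hx, map_zero]
  exact index_nsmul_eq_zero_of_resSubgroupH1_eq_zero (A.subgroupOf B) hAB h0

variable [A.Normal]

/-- `[B : A] • H¹(A, M)^B ⊆ res H¹(B, M)` for `A ≤ B` normal, of finite index and open IN `B`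
(`res ∘ cor` inside `B`, transported along `A ∩ B ≅ A`). Dokchitser–Dokchitser 2010, proof of
Lemma 4.14. [cite: DokchitserDokchitserAnnals2010, Lemma 4.14 (proof)] -/
theorem exists_resOfLe_eq_relIndex_nsmul_rel (h : A ≤ B) (hAB : IsOpen (A.subgroupOf B : Set B))
    [(A.subgroupOf B).FiniteIndex] {y : subgroupH1 A M} (hy : ∀ g : B, conjH1 A M (g : G) y = y) :
    ∃ x : subgroupH1 B M, resOfLe M h x = A.relIndex B • y := by
  have hinv : ∀ g : B,
      conjH1 (A.subgroupOf B) M g (toSubgroupOfH1 A B M y) = toSubgroupOfH1 A B M y :=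
    fun g ↦ by rw [conjH1_toSubgroupOfH1, hy]
  obtain ⟨x, hx⟩ :=
    exists_resSubgroupH1_eq_index_nsmul_of_forall_conjH1_eq (A.subgroupOf B) hAB hinv
  refine ⟨x, ?_⟩
  rw [← ofSubgroupOfH1_resSubgroupH1 M h, hx, map_nsmul, ofSubgroupOfH1_toSubgroupOfH1]
  rfl

end Generic

/-! ## §2 The Selmer groups over `L' = K̄^{H'} ⊆ L = K̄^{H}`, `H = H' ⊓ U` with `U` open -/

section Selmer

variable {K : Type} [Field K] [NumberField K] (W : WeierstrassCurve K) (p : ℕ)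
variable {H H' U : Subgroup (Field.absoluteGaloisGroup K)} [H.Normal] [H'.Normal]

section Local

variable {E : Type} [Field E] [Algebra K E]

omit [NumberField K] [H'.Normal] in
/-- **One place, relative, without openness in `Γ_K`.** If `res_{H'→H} η` dies in
`H¹(H_E, E(K̄_E))` then `[H' : H] • η` dies in `H¹(H'_E, E(K̄_E))`, for `H = H' ⊓ U` with `U`
open: the local subgroup `H_E = H'_E ⊓ U_E` is open IN `H'_E`, of index dividing `[H' : H]`, and
`cor ∘ res` inside `H'_E` kills the local class. Dokchitser–Dokchitser 2010, proof of Lemma 4.14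
(local half), as in the tree's `relIndex_nsmul_mem_localKerOver_of_resOfLe_mem`.
[cite: DokchitserDokchitserAnnals2010, Lemma 4.14 (proof)] -/
theorem relIndex_nsmul_mem_localKerOver_of_resOfLe_mem_rel (h : H ≤ H')
    (hU : IsOpen (U : Set (Field.absoluteGaloisGroup K))) (hHU : H = H' ⊓ U)
    [(H.subgroupOf H').FiniteIndex] {η : W.subgroupH1 p H'}
    (hη : W.resOfLe p h η ∈ W.localKerOver p H E) :
    H.relIndex H' • η ∈ W.localKerOver p H' E := by
  set ι := closureEmb (K := K) E with hι
  rw [localKerOver_eq_ofEmb, localKerOverOfEmb, AddMonoidHom.mem_ker] at hη ⊢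
  rw [W.localResOverOfEmb_resOfLe p ι h] at hη
  set ξ := W.localResOverOfEmb p H' ι η with hξ
  have hle : localSubgroupOfEmb H ι ≤ localSubgroupOfEmb H' ι := Subgroup.comap_mono h
  haveI : (localSubgroupOfEmb H ι).Normal := Subgroup.normal_comap _
  -- relative openness of the local subgroups: `H_E = H'_E ⊓ U_E`, `U_E` open
  have hlocEq : localSubgroupOfEmb H ι = localSubgroupOfEmb H' ι ⊓ localSubgroupOfEmb U ι := by
    rw [localSubgroupOfEmb, localSubgroupOfEmb, localSubgroupOfEmb, hHU, Subgroup.comap_inf]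
  have hopen : IsOpen (((localSubgroupOfEmb H ι).subgroupOf (localSubgroupOfEmb H' ι)) :
      Set (localSubgroupOfEmb H' ι)) :=
    isOpen_subgroupOf_of_eq_inf (isOpen_localSubgroupOfEmb U ι hU) hlocEq
  -- finiteness of the index of `H_E` in `H'_E`: it divides `[H' : H]`
  have hdvd : (localSubgroupOfEmb H ι).relIndex (localSubgroupOfEmb H' ι) ∣ H.relIndex H' := by
    rw [localSubgroupOfEmb, localSubgroupOfEmb, Subgroup.relIndex_comap]
    exact relIndex_dvd_relIndex_of_le (Subgroup.map_comap_le _ _)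
  haveI : ((localSubgroupOfEmb H ι).subgroupOf (localSubgroupOfEmb H' ι)).FiniteIndex :=
    ⟨fun h0 ↦ Subgroup.FiniteIndex.index_ne_zero
      (Nat.eq_zero_of_zero_dvd
        ((show (localSubgroupOfEmb H ι).relIndex (localSubgroupOfEmb H' ι) = 0 from h0) ▸ hdvd))⟩
  have hkill := relIndex_nsmul_eq_zero_of_resOfLe_eq_zero_rel (localPoints W E) hle hopen hη
  obtain ⟨d, hd⟩ := hdvd
  rw [map_nsmul, ← hξ, hd, mul_nsmul, hkill, nsmul_zero]

end Local

/-- **The local half, relative, without openness in `Γ_K`:**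
`res_{H'→H} η ∈ Sel_{p^∞}(E/L) ⇒ [H' : H] • η ∈ Sel_{p^∞}(E/L')` for `H = H' ⊓ U`, `U` open.
[cite: DokchitserDokchitserAnnals2010, Lemma 4.14 (proof)] -/
theorem relIndex_nsmul_mem_selmerGroupOver_of_resOfLe_mem_rel (h : H ≤ H')
    (hU : IsOpen (U : Set (Field.absoluteGaloisGroup K))) (hHU : H = H' ⊓ U)
    [(H.subgroupOf H').FiniteIndex] {η : W.subgroupH1 p H'}
    (hη : W.resOfLe p h η ∈ W.selmerGroupOver p H) :
    H.relIndex H' • η ∈ W.selmerGroupOver p H' := by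
  rw [mem_selmerGroupOver_iff] at hη ⊢
  have hcomm : ∀ σ, W.conjH1 p H σ (W.resOfLe p h η) = W.resOfLe p h (W.conjH1 p H' σ η) :=
    fun σ ↦ (congrArg (fun f ↦ f η)
      (resOfLe_comp_conjH1_holds (M := geomPrimaryTorsion W p) h σ)).symm
  refine ⟨fun v σ ↦ ?_, fun w σ ↦ ?_⟩
  · have h1 := hη.1 v σ
    rw [hcomm] at h1
    rw [map_nsmul]
    exact relIndex_nsmul_mem_localKerOver_of_resOfLe_mem_rel W p h hU hHU h1
  · have h1 := hη.2 w σ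
    rw [hcomm] at h1
    rw [map_nsmul]
    exact relIndex_nsmul_mem_localKerOver_of_resOfLe_mem_rel W p h hU hHU h1

/-! ## §3 Bijectivity for `p ∤ [H' : H]` -/

variable [Fact p.Prime]

omit [H.Normal] [H'.Normal] [Fact p.Prime] in
/-- `H¹(H', E[p^∞])` is `p`-primary for `H'` CLOSED in the (compact) absolute Galois group: a
continuous cocycle on the compact `H'` with values in the discrete `p`-primary `E[p^∞]` is
killed by one power of `p`. Greenberg (1999), §2. [cite: GreenbergLNM1716, §2] -/
theorem exists_pow_nsmul_eq_zero_subgroupH1_of_isClosed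
    (hH' : IsClosed (H' : Set (Field.absoluteGaloisGroup K))) (x : W.subgroupH1 p H') :
    ∃ k : ℕ, p ^ k • x = 0 := by
  haveI : CompactSpace (Field.absoluteGaloisGroup K) := compactSpace_absoluteGaloisGroup K
  have hM : ∀ m : geomPrimaryTorsion W p, ∃ k : ℕ, p ^ k • m = 0 := fun m ↦ by
    obtain ⟨k, hk⟩ := AddCommGroup.mem_primaryComponent.mp m.2
    exact ⟨k, Subtype.ext (by rw [AddSubmonoidClass.coe_nsmul, hk, ZeroMemClass.coe_zero])⟩
  exact exists_pow_nsmul_eq_zero_subgroupH1 H' hH' hM x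

/-- **Prime-to-`p` Galois descent for `Sel_{p^∞}` (kernel brick 1 of [C]).** For an elliptic curve
`E = W` over a number field `K`, a prime `p`, a CLOSED normal subgroup `H' ≤ Γ_K` (`L' = K̄^{H'}`,
any Galois extension of `K`, finite or not) and `H = H' ⊓ U` with `U ≤ Γ_K` an OPEN normal
subgroup (`L = L'·K̄^U`) such that `p ∤ [H' : H] = [L : L']`: the restriction map
`Sel_{p^∞}(E/L') → Sel_{p^∞}(E/L)^{Gal(L/L')}` (the tree's `selmerRelRestriction`) is a
BIJECTION. Proof: its kernel is killed by `[H' : H]` (§1) and `[H' : H] •` (invariants) consists of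
restrictions of Selmer classes up to `[H' : H]` (§1–§2), while all groups are `p`-primary (§3), on
which multiplication by `[H' : H]` is bijective (§0). Greenberg, LNM 1716 (1999), §5 p. 143 (the
displayed isomorphism `H¹(ℚ_Σ/ℚ_∞, C) ≅ H¹(ℚ_Σ/F_∞, C)^Δ` "taking into account the local
conditions", `#Δ` prime to `p`); Dokchitser–Dokchitser 2010, Lemma 4.14 (mechanism).
[cite: GreenbergLNM1716, §5 p. 143] -/
theorem selmerRelRestriction_bijective_of_coprime [W.IsElliptic] (h : H ≤ H') [U.Normal]
    (hU : IsOpen (U : Set (Field.absoluteGaloisGroup K))) (hHU : H = H' ⊓ U)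
    (hH' : IsClosed (H' : Set (Field.absoluteGaloisGroup K))) [(H.subgroupOf H').FiniteIndex]
    (hcop : (H.relIndex H').Coprime p) :
    Function.Bijective (W.selmerRelRestriction p h) := by
  have hHo : IsOpen (H.subgroupOf H' : Set H') := isOpen_subgroupOf_of_eq_inf hU hHU
  have hHc : IsClosed (H : Set (Field.absoluteGaloisGroup K)) := by
    rw [hHU, Subgroup.coe_inf]
    exact hH'.inter (Subgroup.isClosed_of_isOpen U hU)
  -- `p`-primarity of the source and of the target
  have hA : ∀ a : W.selmerGroupOver p H', ∃ k : ℕ, p ^ k • a = 0 := fun a ↦ by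
    obtain ⟨k, hk⟩ := exists_pow_nsmul_eq_zero_subgroupH1_of_isClosed W p hH'
      (a : W.subgroupH1 p H')
    exact ⟨k, Subtype.ext (by rw [AddSubmonoidClass.coe_nsmul, hk, ZeroMemClass.coe_zero])⟩
  have hle : W.selmerGroupOverRelInvariants p H H' ≤ W.selmerGroupOver p H := fun y hy ↦
    ((W.mem_selmerGroupOverRelInvariants_iff p y).mp hy).1
  have hB : ∀ b : W.selmerGroupOverRelInvariants p H H', ∃ k : ℕ, p ^ k • b = 0 := fun b ↦ by
    obtain ⟨k, hk⟩ := exists_pow_nsmul_eq_zero_subgroupH1_of_isClosed W p hHc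
      (b : W.subgroupH1 p H)
    exact ⟨k, Subtype.ext (by rw [AddSubmonoidClass.coe_nsmul, hk, ZeroMemClass.coe_zero])⟩
  refine ⟨fun a₁ a₂ h12 ↦ ?_, fun b ↦ ?_⟩
  · -- injectivity: the kernel is killed by `[H' : H]`, prime to `p`
    rw [← sub_eq_zero] at h12 ⊢
    rw [← map_sub] at h12
    set a := a₁ - a₂ with ha
    have h0 : W.resOfLe p h (a : W.subgroupH1 p H') = 0 := by
      rw [← coe_selmerRelRestriction, h12]; rfl
    have h1 := relIndex_nsmul_eq_zero_of_resOfLe_eq_zero_rel (geomPrimaryTorsion W p) h hHo h0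
    have h2 : H.relIndex H' • a = 0 :=
      Subtype.ext (by rw [AddSubmonoidClass.coe_nsmul, h1, ZeroMemClass.coe_zero])
    exact eq_zero_of_nsmul_eq_zero_of_coprime hA hcop h2
  · -- surjectivity: `b = n • b₀`, `n • b₀ = res x`, `n • x ∈ Sel(E/L')`, `res (m n x) = b`
    set n := H.relIndex H' with hn
    obtain ⟨b₀, hb₀⟩ := exists_nsmul_eq_of_coprime hB (Nat.Coprime.mul_left hcop hcop) b
    obtain ⟨hb₀T, hb₀inv⟩ := (W.mem_selmerGroupOverRelInvariants_iff p _).mp b₀.2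
    obtain ⟨x, hx⟩ :=
      exists_resOfLe_eq_relIndex_nsmul_rel (geomPrimaryTorsion W p) h hHo hb₀inv
    have hxT : W.resOfLe p h x ∈ W.selmerGroupOver p H := by
      change Literature.NumberTheory.EllipticCurves.resOfLe (geomPrimaryTorsion W p) h x ∈ _
      rw [hx]; exact AddSubgroup.nsmul_mem _ hb₀T _
    have hxS := relIndex_nsmul_mem_selmerGroupOver_of_resOfLe_mem_rel W p h hU hHU hxT
    refine ⟨⟨n • x, hxS⟩, ?_⟩
    rw [← hb₀]
    apply Subtype.ext
    rw [coe_selmerRelRestriction, AddSubmonoidClass.coe_nsmul]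
    change W.resOfLe p h (n • x) = _
    rw [map_nsmul]
    change n • Literature.NumberTheory.EllipticCurves.resOfLe (geomPrimaryTorsion W p) h x = _
    rw [hx, ← mul_nsmul]

/-! ## §4 The cyclotomic case: `L' = K_∞`, `L = K_∞ · K̄^U` (Greenberg, LNM 1716, p. 143) -/

variable (κ : ZpExtension K p)

omit [H.Normal] [H'.Normal] in
/-- `Sel_{p^∞}(E/K_∞)` of file `IwasawaSelmer` is the subgroup-model Selmer group over
`K̄^{ker κ} = K_∞` (definitional unfolding, recorded for rewriting). [folklore] -/
theorem selmerInfty_eq_selmerGroupOver : W.selmerInfty κ = W.selmerGroupOver p κ.kerSubgroup :=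
  rfl

/-- **Greenberg's prime-to-`p` descent over the cyclotomic tower, for `E[p^∞]`.** For an elliptic
curve `E = W` over a number field `K`, a `ℤ_p`-extension `K_∞ = K̄^{ker κ}` of `K` and an OPEN
normal subgroup `U ≤ Γ_K` with `p ∤ [Γ_K : U]` (`F = K̄^U`, `[F : K]` prime to `p`,
`F_∞ = F·K_∞ = K̄^{ker κ ⊓ U}`, `Δ = Gal(F_∞/K_∞)` of order dividing `[F : K]`): the restriction
`Sel_{p^∞}(E/K_∞) → Sel_{p^∞}(E/F_∞)^{Δ}` is a bijection — "The restriction map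
`H¹(ℚ_Σ/ℚ_∞, C) → H¹(ℚ_Σ/F_∞, C)^Δ` is an isomorphism … Taking into account the local
conditions, the restriction map induces an isomorphism" (Greenberg, LNM 1716, p. 143, there for a
rank-one `C`; here for `C = E[p^∞]` over any number field, `Δ`-invariants taken as the classes
fixed by the conjugation action of every `g ∈ Gal(K̄/K_∞)`). With `U = Gal(K̄/K(√p*))`,
`p` odd, this is step (i) of the transport [C] for the pair `(E, p)` (see the module docstring).
[cite: GreenbergLNM1716, §5 p. 143] -/
theorem selmerInfty_relRestriction_bijective [W.IsElliptic] [U.Normal]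
    (hU : IsOpen (U : Set (Field.absoluteGaloisGroup K))) (hcop : U.index.Coprime p) :
    Function.Bijective
      (W.selmerRelRestriction p (inf_le_left : κ.kerSubgroup ⊓ U ≤ κ.kerSubgroup)) := by
  -- an open subgroup of the compact `Γ_K` has finite index
  haveI : CompactSpace (Field.absoluteGaloisGroup K) := compactSpace_absoluteGaloisGroup K
  haveI : DiscreteTopology (Field.absoluteGaloisGroup K ⧸ U) := QuotientGroup.discreteTopology hU
  haveI : Finite (Field.absoluteGaloisGroup K ⧸ U) := finite_of_compact_of_discrete
  haveI : U.FiniteIndex := Subgroup.finiteIndex_of_finite_quotient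
  haveI : ((κ.kerSubgroup ⊓ U).subgroupOf κ.kerSubgroup).FiniteIndex := by
    rw [Subgroup.inf_subgroupOf_left]; infer_instance
  have hrel : (κ.kerSubgroup ⊓ U).relIndex κ.kerSubgroup ∣ U.index := by
    rw [Subgroup.inf_relIndex_left]
    exact Subgroup.relIndex_dvd_index_of_normal U κ.kerSubgroup
  exact selmerRelRestriction_bijective_of_coprime W p inf_le_left hU rfl κ.isClosed_kerSubgroup
    (Nat.Coprime.coprime_dvd_left hrel hcop)

end Selmer

end Summit.BirchSwinnertonDyer.Rank1Residual.AdditivePotMult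

end
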